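import Summits.QuantumFields.YangMills.Theorems.BalabanUVNodesN11NoExpansionAtRecord13CoP
import Literature.MathematicalPhysics.QuantumFieldTheory.Balaban1983to89.Node00.Record13SepCoPHChi
import Literature.MathematicalPhysics.QuantumFieldTheory.Balaban1983to89.Node00.Record13ResidualsRChi

/-!
# χ-GENERIC RE-ISSUE (WORK ORDER RC-1 «RE-CENTRE THE RECORD», director-ym №462 (B) ∕ №467 (D)) of `BalabanUVNodesN11NoExpansionAtRecord13CoP`

Cell `pub-ymgap` (HUMAN RULING D-0062, Track A), seat `pub-ymgap-dag-n11-d` (N11 [B14] s2; N11-σ campaign, `N11-G44-RC1-REACH-CENSUS.md`).  The CENTRE-TYPED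
declarations of `BalabanUVNodesN11NoExpansionAtRecord13CoP` (those whose statement reads the (2.9) cut-off centre through `gOfRecord₁₃ ∕ EOfRecord₁₃ ∕ Provisos₁₃… ∕ T∕SLaw₁₃… ∕
UbgOfRecord₁₃… ∕ WtOfRecord₁₃… ∕ datum∕tower∕coreOfRecord₁₃…`) RE-ISSUED VERBATIM in the β-slot `χ : ChiSlot F N` over [Ax-3b]∕[Ax-3c]∕[Ax-3d]'s χ-generic carriers
(`Node00/Record13Chi` ∕ `Record13CoPHChi` ∕ `Record13SepCoPHChi`): σ = (binder `(χ : ChiSlot F N)` after `θ`; Node00 defs `X ↦ XChi … χ`; Node00 rows `Y ↦ Y_chi`;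
this lane's sibling modules `…Chi` for Summits-side dependencies); SAME short names in the sibling namespace `…BalabanUVNodesN11NoExpansionAtRecord13CoPChi` (consumers switch by namespace);
the 7 centre-FREE declarations of the original are NOT copied — they are reused BY NAME (`open … (…)` below).  At `χ := chiβOfRecord₁₃ θ` every statement here is
DEFINITIONALLY the landed one ([Ax-3b]'s `rfl` receipts); at `χ := chiβOfRecord₁₃Ax θ` it is what the Ax-record's N11 machine reads.  Nothing of record edited (body-freeze №460 (2)).

HONEST FRAMING.  Count-neutral kernel re-elaboration of landed N11 bookkeeping∕estimates in a parameter; every HYPOTHESIS of the original stays a hypothesis; nothing of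
Bałaban asserted beyond what the original file proves; N11 NOT discharged; K-items untouched; counts unmoved.  One finite `𝕋⁴_{L^K}` programme at fixed `ε = L^{−K}` —
NOT ℝ⁴, NOT OS, NOT a mass gap, NOT Clay.  No `sorry`∕`instance`∕`notation`.  Sources: as the original module, plus [I] = [Balaban1987RG1] (2.9) p.266 (the cut-off's centre).
-/

noncomputable section

open MeasureTheory
open scoped BigOperators Matrix.Norms.L2Operator

namespace Summit.QuantumFields.YangMills.Theorems.BalabanUVNodesN11NoExpansionAtRecord13CoPChi

open Summit.QuantumFields.YangMills.Theorems.BalabanUVNodesN11NoExpansionAtRecord13CoP (noExpIntegrand_WtOfRecord₁₃P_sect2Operand_of_Omega_empty tLaw₁₃CoP_zero_clause_of_Omega_empty tLaw₁₃CoP_zero_coherence_of_Omega_empty tLaw₁₃CoP_zero_coherence_of_Zt_eq_ZtOfRecord tLaw₁₃CoP_zero_coherence_of_hasResidualsOfRecord UbgMSCoPOfRecord_succ_eq_init_of_Omega_empty UbgMSCoPOfRecordB_succ_eq_init_of_Omega_empty)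
open Literature.MathematicalPhysics.QuantumFieldTheory.Balaban1983to89 T4Continuum Node00 Node00.Tk DagBinding
open B15DeterminingSets B15DeterminingSetsB
open BalabanUVNodesN11BackgroundCoPMeasurableB (lamBondsSeq_succ_eq_of_Omega_empty_of_agree)
open BalabanUVNodesN11NoExpansionTermFree (exp_action23_one_eq_rhoZero_of_Omega_empty₁₃)
open BalabanUVNodesN11NoExpansionZetaSpec (noExpIntegrand_eq_zetaFactor_mul sect2Slot_one_ae_eq_transport_of_Omega_empty)
open BalabanUVNodesN11NoExpansionZetaSpecAtCoP (UbgOfRecord₁₃CoP_one_pairCfg_of_Omega_empty WtOfRecord₁₃P_ζ_zero_univ WtOfRecord₁₃P_w_zero_empty)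
open BalabanUVNodesN11NoExpansionRoughFibre (transportOfRecord_const_mul)

variable {F : T4Family} {N : ℕ} [NeZero N]

/-! ## §1. LEVEL 1 at the `CoP` record: the (S1ᵀ)₁₃CoP,₀ clause at the all-large-field sequence as a TERM-FREE, REGULARITY-FREE transport equation -/

section LevelOne

variable (θ : Stage13Params F N) (χ : ChiSlot F N) (p : B12.RunParams)

end LevelOne

/-! ## §2. The support-edition class and background of record are UNCHANGED along a no-expansion step (`k ≥ 1`); at `k = 0` for EVERY configuration -/

section Backgrounds

variable {ν : Stage7Numerics} {M : ℕ} {g : ℕ → ℝ} {K k : ℕ}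

variable (θ : Stage13Params F N) (χ : ChiSlot F N) (p : B12.RunParams)

/-- **THE `CoP` BACKGROUND MAP OF RECORD IS UNCHANGED ALONG A NO-EXPANSION STEP, `k ≥ 1`**: `UbgOfRecord₁₃CoP θ p (k+1) s′ = UbgOfRecord₁₃CoP θ p k (init s′)`.
[cite: Balaban1988Convergent, (2.12)–(2.13) pp.256–257] -/
theorem UbgOfRecord₁₃CoP_succ_eq_init_of_Omega_empty {k : ℕ} (hk : 1 ≤ k)
    (s : SeqOfRecord F θ.ν θ.τ9.M (gOfRecord₁₃Chi F N θ χ p) p.K (k + 1)) (hΩ : s.Ω (k + 1) = ∅) :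
    UbgOfRecord₁₃CoPChi F N θ χ p (k + 1) s = UbgOfRecord₁₃CoPChi F N θ χ p k s.init := by
  obtain ⟨k', rfl⟩ : ∃ k', k = k' + 1 := ⟨k - 1, by omega⟩
  -- Stage-2 SEAM-ROBUST (WORKPLAN-IIIB, director-ym №343): (b)-datum background before the `Record13CoP` seam edit, print-datum background after it; the step
  -- equation holds for both (above), so this proof elaborates in either state of the tree.
  rw [UbgOfRecord₁₃CoP_succ_chi, UbgOfRecord₁₃CoP_succ_chi]
  apply_rules only [hk, hΩ, UbgMSCoPOfRecord_succ_eq_init_of_Omega_empty, UbgMSCoPOfRecordB_succ_eq_init_of_Omega_empty]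

/-- **… AND AT `k = 0` FOR EVERY RETAINED CONFIGURATION** (the level-`0` pin `𝐖 ↦ 𝐖 0` of the record against the level-`1` support-edition minimiser, which
reads the fine field unconditionally at `Ω₁ = ∅` — sibling file): `U_1(s′)(𝐖) = U_0(init s′)(𝐖) = 𝐖 0`. [cite: Balaban1988Convergent, Thm 1 p.262, (2.12) p.256, p.248 L17–20] -/
theorem UbgOfRecord₁₃CoP_one_eq_init_of_Omega_empty (s : SeqOfRecord F θ.ν θ.τ9.M (gOfRecord₁₃Chi F N θ χ p) p.K 1) (hΩ : s.Ω 1 = ∅)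
    (W : MSField (F.P p.K) (SU N)) : UbgOfRecord₁₃CoPChi F N θ χ p 1 s W = UbgOfRecord₁₃CoPChi F N θ χ p 0 s.init W := by
  rw [UbgOfRecord₁₃CoP_zero_chi]
  -- Stage-2 SEAM-ROBUST: node00-def-R's `…_one_of_Omega_empty` for the (b)-datum background, its S2c twin for print's datum.
  apply_rules only [hΩ, UbgMSCoPOfRecord_one_of_Omega_empty, UbgMSCoPOfRecordB_one_of_Omega_empty]

end Backgrounds

end Summit.QuantumFields.YangMills.Theorems.BalabanUVNodesN11NoExpansionAtRecord13CoPChi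

end
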